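import Summits.QuantumFields.YangMills.Theorems.PoincareLipschitzKuhnEnergy
import Mathlib.MeasureTheory.Function.LocallyIntegrable
import HarnessLib

/-!
# The Courant `P1` interpolant on the Freudenthal–Kuhn triangulation — continuity and the `L²` DISTANCE-TO-THE-SPHERE row
# (K2 organ `hImproveCoreFlat`, ORGAN memo §4 brick B3, mesh-side half; LINE 25 `stub_latticeToContinuumLimit` (Γ1): «the
# blow-down limit takes values in `S³`»; cell ym3-torus, seat px7 g7)

Helper toward crux `stmt-QuantumFields-19936` (`Summit.QuantumFields.YangMills.Theses.UnitScaleTilt.HistoryTailL`).  Sibling of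
`PoincareLipschitzKuhnEnergy` (per-cube and big-box energy identities).  WHAT IS PROVED (all `theorem`s):
* `continuous_interp` — the interpolant is continuous (finite sum of continuous hats);
* `normSq_interp_sub_le_on_openSimplex` — on an open Kuhn simplex `‖I x − u y‖² ≤ 3·(path energy)`;
* ★★ `integral_cube_normSq_sub_le` — the per-cube Poincaré-type row `∫_{cube y} ‖I x − u y‖² ≤ 3 · ∫_{cube y} ∑_i ‖∂_i I‖²`;
* `sq_norm_sub_one_le` — `(‖a‖ − 1)² ≤ ‖a − b‖²` for a unit vector `b`;
* ★★★ `integral_bigBox_sq_norm_sub_one_le` — for UNIT lattice data on `box z (R+1)`,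
  `∫_{z−R < x < z+R+1} (‖I x‖ − 1)² ≤ 3 · ∑_{w ∈ box z (R+1)} ∑_μ ‖u (w + e_μ) − u w‖²`:
  after the blow-down rescaling (`PoincareLipschitzBlowDownRescale`) the left side is `R³ · ∫_{unit box} (‖J‖ − 1)²` and the right
  side is `≤ 3Λ₀R` under the organ's energy bound — the rescaled interpolants converge to the sphere `‖·‖ = 1` in `L²`, which is
  what puts the (Γ1) limit on `S³`.

HONEST: bookkeeping over the siblings; nothing of `stub_latticeToContinuumLimit`, `hImproveCoreFlat`, K1, `MeanDeviationL`,
`BlockLipschitzL`, `HistoryTailL` or any rung statement is proved; YM₃ on T³ is ladder rung R3 — not d = 4, not infinite volume, not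
a mass gap, not Clay.
-/

open scoped BigOperators
open Literature.MathematicalPhysics.QuantumFieldTheory.Balaban1983to89 B4Eq19LatticeOperators

noncomputable section

namespace Summit.QuantumFields.YangMills.Theorems.PoincareLipschitzKuhnSphereDistance

open MeasureTheory
open Summit.QuantumFields.YangMills.Theorems.PoincareLipschitzKuhnHat
open Summit.QuantumFields.YangMills.Theorems.PoincareLipschitzKuhnInterpolant
open Summit.QuantumFields.YangMills.Theorems.PoincareLipschitzKuhnSimplexVolume
open Summit.QuantumFields.YangMills.Theorems.PoincareLipschitzKuhnPathSums
open Summit.QuantumFields.YangMills.Theorems.PoincareLipschitzKuhnEnergy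

variable {E : Type*} [NormedAddCommGroup E] [NormedSpace ℝ E]
variable (φ : (Fin 3 → ℝ) → ℝ)

/-! ## §9 Continuity of the interpolant and the `L²` distance-to-the-data (distance-to-`S³`) row -/

/-- The interpolant is continuous on `EuclideanSpace ℝ (Fin 3)` (a finite sum of continuous hats times constants). -/
theorem continuous_interp
    (hφ : ∀ t, φ t = max 0 (1 + min 0 (min (t 0) (min (t 1) (t 2))) - max 0 (max (t 0) (max (t 1) (t 2)))))
    (S : Finset (Zd 3)) (u : Zd 3 → E) (I : EuclideanSpace ℝ (Fin 3) → E)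
    (hI : ∀ x, I x = ∑ w ∈ S, φ (fun i => x i - (w i : ℝ)) • u w) : Continuous I := by
  have hIeq : I = fun x => ∑ w ∈ S, φ (fun i => x i - (w i : ℝ)) • u w := funext hI
  rw [hIeq]
  refine continuous_finsetSum _ fun w _ => ?_
  refine ((continuous_hat φ hφ).comp ?_).smul continuous_const
  exact continuous_pi fun i => ((EuclideanSpace.proj i).continuous).sub continuous_const

/-- On the open Kuhn simplex of `σ` at `y`, the squared distance to the corner value is at most `3×` the path energy. -/
theorem normSq_interp_sub_le_on_openSimplex
    (hφ : ∀ t, φ t = max 0 (1 + min 0 (min (t 0) (min (t 1) (t 2))) - max 0 (max (t 0) (max (t 1) (t 2)))))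
    (S : Finset (Zd 3)) (u : Zd 3 → E) (I : EuclideanSpace ℝ (Fin 3) → E)
    (hI : ∀ x, I x = ∑ w ∈ S, φ (fun i => x i - (w i : ℝ)) • u w)
    (y : Zd 3) (σ : Equiv.Perm (Fin 3)) (hS0 : y ∈ S) (hS1 : y + unitVec (σ 0) ∈ S)
    (hS2 : y + unitVec (σ 0) + unitVec (σ 1) ∈ S) (hS3 : y + unitVec (σ 0) + unitVec (σ 1) + unitVec (σ 2) ∈ S)
    {x : EuclideanSpace ℝ (Fin 3)}
    (h0 : (y (σ 2) : ℝ) < x (σ 2)) (h1 : x (σ 2) - y (σ 2) < x (σ 1) - y (σ 1))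
    (h2 : x (σ 1) - y (σ 1) < x (σ 0) - y (σ 0)) (h3 : x (σ 0) < y (σ 0) + 1) :
    ‖I x - u y‖ ^ 2 ≤ 3 * (‖u (y + unitVec (σ 0)) - u y‖ ^ 2
      + ‖u (y + unitVec (σ 0) + unitVec (σ 1)) - u (y + unitVec (σ 0))‖ ^ 2
      + ‖u (y + unitVec (σ 0) + unitVec (σ 1) + unitVec (σ 2)) - u (y + unitVec (σ 0) + unitVec (σ 1))‖ ^ 2) := by
  have h := norm_interp_sub_le φ hφ S u I hI y σ hS0 hS1 hS2 hS3 h0.le h1.le h2.le h3.le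
  set a := ‖u (y + unitVec (σ 0)) - u y‖
  set b := ‖u (y + unitVec (σ 0) + unitVec (σ 1)) - u (y + unitVec (σ 0))‖
  set c := ‖u (y + unitVec (σ 0) + unitVec (σ 1) + unitVec (σ 2)) - u (y + unitVec (σ 0) + unitVec (σ 1))‖
  have hn : 0 ≤ ‖I x - u y‖ := norm_nonneg _
  calc ‖I x - u y‖ ^ 2 ≤ (a + b + c) ^ 2 := by gcongr
    _ ≤ 3 * (a ^ 2 + b ^ 2 + c ^ 2) := by nlinarith [sq_nonneg (a - b), sq_nonneg (b - c), sq_nonneg (a - c)]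

/-- ★★ THE PER-CUBE `L²` ROW: `∫_{cube y} ‖I x − u y‖² ≤ 3 · ∫_{cube y} ∑_i ‖∂_i I‖²` — a Poincaré-type inequality on one cube
with constant `3`, the distance of the interpolant to the corner datum is paid by the cube's Dirichlet energy. -/
theorem integral_cube_normSq_sub_le
    (hφ : ∀ t, φ t = max 0 (1 + min 0 (min (t 0) (min (t 1) (t 2))) - max 0 (max (t 0) (max (t 1) (t 2)))))
    (S : Finset (Zd 3)) (u : Zd 3 → E) (I : EuclideanSpace ℝ (Fin 3) → E)
    (hI : ∀ x, I x = ∑ w ∈ S, φ (fun i => x i - (w i : ℝ)) • u w)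
    (y : Zd 3) (hS : ∀ v : Zd 3, (∀ i, v i = 0 ∨ v i = 1) → y + v ∈ S) :
    ∫ x in {x : EuclideanSpace ℝ (Fin 3) | ∀ i, (y i : ℝ) < x i ∧ x i < y i + 1}, ‖I x - u y‖ ^ 2 ≤
      3 * ∫ x in {x : EuclideanSpace ℝ (Fin 3) | ∀ i, (y i : ℝ) < x i ∧ x i < y i + 1},
        ∑ i : Fin 3, ‖fderiv ℝ I x (EuclideanSpace.single i (1:ℝ))‖ ^ 2 := by
  set U : Equiv.Perm (Fin 3) → Set (EuclideanSpace ℝ (Fin 3)) := fun σ =>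
    {x | (y (σ 2) : ℝ) < x (σ 2) ∧ x (σ 2) - y (σ 2) < x (σ 1) - y (σ 1) ∧
      x (σ 1) - y (σ 1) < x (σ 0) - y (σ 0) ∧ x (σ 0) < y (σ 0) + 1} with hU
  set h : EuclideanSpace ℝ (Fin 3) → ℝ := fun x => ‖I x - u y‖ ^ 2 with hh
  set c : Equiv.Perm (Fin 3) → ℝ := fun σ => ‖u (y + unitVec (σ 0)) - u y‖ ^ 2
        + ‖u (y + unitVec (σ 0) + unitVec (σ 1)) - u (y + unitVec (σ 0))‖ ^ 2
        + ‖u (y + unitVec (σ 0) + unitVec (σ 1) + unitVec (σ 2)) - u (y + unitVec (σ 0) + unitVec (σ 1))‖ ^ 2 with hc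
  have hUmeas : ∀ σ, MeasurableSet (U σ) := fun σ => (isOpen_openSimplex y σ).measurableSet
  have hdisj : Set.Pairwise (↑(Finset.univ : Finset (Equiv.Perm (Fin 3)))) (Function.onFun Disjoint U) := by
    intro σ _ τ _ hne
    refine Set.disjoint_left.mpr fun x hxσ hxτ => hne ?_
    exact perm_eq_of_strictChain (x := fun i => x i - (y i : ℝ)) hxσ.2.1 hxσ.2.2.1 hxτ.2.1 hxτ.2.2.1
  have hvol : ∀ σ, volume (U σ) = 1 / 6 := fun σ => volume_openSimplex y σ
  have hcont : Continuous h := ((continuous_interp φ hφ S u I hI).sub continuous_const).norm.pow 2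
  have hbound : ∀ σ, ∀ x ∈ U σ, h x ≤ 3 * c σ := by
    intro σ x hx
    obtain ⟨hS0, hS1, hS2, hS3⟩ := pathVertices_mem S y hS σ
    exact normSq_interp_sub_le_on_openSimplex φ hφ S u I hI y σ hS0 hS1 hS2 hS3 hx.1 hx.2.1 hx.2.2.1 hx.2.2.2
  have hfin : ∀ σ, volume (U σ) ≠ ⊤ := fun σ => by rw [hvol]; norm_num
  have hint : ∀ σ, IntegrableOn h (U σ) volume := fun σ =>
    Measure.integrableOn_of_bounded (hfin σ) hcont.aestronglyMeasurable
      ((ae_restrict_iff' (hUmeas σ)).mpr (ae_of_all _ fun x hx => by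
        rw [Real.norm_of_nonneg (by positivity)]; exact hbound σ x hx))
  calc ∫ x in {x : EuclideanSpace ℝ (Fin 3) | ∀ i, (y i : ℝ) < x i ∧ x i < y i + 1}, h x
        = ∫ x in ⋃ σ ∈ (Finset.univ : Finset (Equiv.Perm (Fin 3))), U σ, h x :=
        (setIntegral_congr_set (iUnion_openSimplex_ae_eq_cube y)).symm
    _ = ∑ σ : Equiv.Perm (Fin 3), ∫ x in U σ, h x :=
        integral_biUnion_finset _ (fun σ _ => hUmeas σ) hdisj (fun σ _ => hint σ)
    _ ≤ ∑ σ : Equiv.Perm (Fin 3), ∫ x in U σ, (3 * c σ : ℝ) := by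
        refine Finset.sum_le_sum fun σ _ => ?_
        exact setIntegral_mono_on (hint σ) (integrableOn_const (hfin σ)) (hUmeas σ) (hbound σ)
    _ = ∑ σ : Equiv.Perm (Fin 3), 3 * ((1 / 6 : ℝ) * c σ) := by
        refine Finset.sum_congr rfl fun σ _ => ?_
        rw [setIntegral_const, smul_eq_mul, measureReal_def, hvol]
        norm_num; ring
    _ = 3 * ((1 / 6 : ℝ) * ∑ σ : Equiv.Perm (Fin 3), c σ) := by rw [Finset.mul_sum, Finset.mul_sum]
    _ = 3 * ∫ x in {x : EuclideanSpace ℝ (Fin 3) | ∀ i, (y i : ℝ) < x i ∧ x i < y i + 1},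
          ∑ i : Fin 3, ‖fderiv ℝ I x (EuclideanSpace.single i (1:ℝ))‖ ^ 2 := by
        rw [integral_cube_energyDensity_eq φ hφ S u I hI y hS]

omit [NormedSpace ℝ E] in
/-- `(‖a‖ − 1)² ≤ ‖a − b‖²` for a unit vector `b`: the distance to the sphere is at most the distance to any point of it. -/
theorem sq_norm_sub_one_le {a b : E} (hb : ‖b‖ = 1) : (‖a‖ - 1) ^ 2 ≤ ‖a - b‖ ^ 2 := by
  have h := abs_norm_sub_norm_le a b
  rw [hb] at h
  have h' : |‖a‖ - 1| ≤ ‖a - b‖ := h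
  nlinarith [abs_nonneg (‖a‖ - 1), sq_abs (‖a‖ - 1), norm_nonneg (a - b)]

/-- ★★★ THE BIG-BOX DISTANCE-TO-THE-SPHERE ROW: for UNIT data on `box z (R+1)`,
`∫_{z−R < x < z+R+1} (‖I x‖ − 1)² ≤ 3 · ∑_{w ∈ box z (R+1)} ∑_μ ‖u (w + e_μ) − u w‖²` — after the blow-down rescaling the left side is
`R³·∫_{unit} (‖J‖ − 1)²` while the right side is `≤ 3Λ₀·R`, so the rescaled interpolants converge to the sphere in `L²`. -/
theorem integral_bigBox_sq_norm_sub_one_le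
    (hφ : ∀ t, φ t = max 0 (1 + min 0 (min (t 0) (min (t 1) (t 2))) - max 0 (max (t 0) (max (t 1) (t 2)))))
    (S : Finset (Zd 3)) (u : Zd 3 → E) (I : EuclideanSpace ℝ (Fin 3) → E)
    (hI : ∀ x, I x = ∑ w ∈ S, φ (fun i => x i - (w i : ℝ)) • u w) (hu : ∀ w, ‖u w‖ = 1)
    (z : Zd 3) (R : ℤ) (hS : ∀ w ∈ box z (R + 1), w ∈ S) :
    ∫ x in {x : EuclideanSpace ℝ (Fin 3) | ∀ i, (z i : ℝ) - R < x i ∧ x i < z i + R + 1}, (‖I x‖ - 1) ^ 2 ≤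
      3 * ∑ w ∈ box z (R + 1), ∑ μ : Fin 3, ‖u (w + unitVec μ) - u w‖ ^ 2 := by
  have hcorner : ∀ y ∈ box z R, ∀ v : Zd 3, (∀ i, v i = 0 ∨ v i = 1) → y + v ∈ S :=
    fun y hy v hv => hS _ (add_mem_box_succ hy hv)
  have hdisj : Set.Pairwise (↑(box z R))
      (Function.onFun Disjoint fun y : Zd 3 => {x : EuclideanSpace ℝ (Fin 3) | ∀ i, (y i : ℝ) < x i ∧ x i < y i + 1}) :=
    fun y _ y' _ hne => disjoint_cube hne
  have hcontI := continuous_interp φ hφ S u I hI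
  have hcont : Continuous fun x => (‖I x‖ - 1) ^ 2 := (hcontI.norm.sub continuous_const).pow 2
  -- integrability on each cube: bounded by 4 (‖I x‖ ≤ ‖I x - u y‖ + 1 is not needed: use (‖I‖-1)² ≤ ‖I - u y‖² ≤ 3·c)
  have hcube : ∀ y ∈ box z R,
      IntegrableOn (fun x => (‖I x‖ - 1) ^ 2) {x : EuclideanSpace ℝ (Fin 3) | ∀ i, (y i : ℝ) < x i ∧ x i < y i + 1} volume ∧
      ∫ x in {x : EuclideanSpace ℝ (Fin 3) | ∀ i, (y i : ℝ) < x i ∧ x i < y i + 1}, (‖I x‖ - 1) ^ 2 ≤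
        3 * ∫ x in {x : EuclideanSpace ℝ (Fin 3) | ∀ i, (y i : ℝ) < x i ∧ x i < y i + 1},
          ∑ i : Fin 3, ‖fderiv ℝ I x (EuclideanSpace.single i (1:ℝ))‖ ^ 2 := by
    intro y hy
    have hcont2 : Continuous fun x => ‖I x - u y‖ ^ 2 := (hcontI.sub continuous_const).norm.pow 2
    -- both integrands are continuous; the cube has finite measure; `‖I x - u y‖²` is bounded on the cube by the
    -- per-simplex bound, hence so is `(‖I x‖ - 1)²`
    have hptw : ∀ x, (‖I x‖ - 1) ^ 2 ≤ ‖I x - u y‖ ^ 2 := fun x => sq_norm_sub_one_le (hu y)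
    have hfin : volume {x : EuclideanSpace ℝ (Fin 3) | ∀ i, (y i : ℝ) < x i ∧ x i < y i + 1} ≠ ⊤ := by
      rw [volume_cube y]; norm_num
    -- a crude uniform bound on the cube: ‖I x - u y‖² ≤ 3·(4+4+4) since all data are unit vectors
    have hB : ∀ x ∈ {x : EuclideanSpace ℝ (Fin 3) | ∀ i, (y i : ℝ) < x i ∧ x i < y i + 1}, ‖I x - u y‖ ^ 2 ≤ 36 := by
      intro x hx
      -- `x` lies in the closed simplex of some `σ`; use the affine bound there
      obtain ⟨σ, h1, h2⟩ := exists_perm_antitone (fun i => x i - (y i : ℝ))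
      obtain ⟨hS0, hS1, hS2, hS3⟩ := pathVertices_mem S y (hcorner y hy) σ
      have h0 : (y (σ 2) : ℝ) ≤ x (σ 2) := (hx (σ 2)).1.le
      have h3 : x (σ 0) ≤ (y (σ 0) : ℝ) + 1 := (hx (σ 0)).2.le
      have hle := norm_interp_sub_le φ hφ S u I hI y σ hS0 hS1 hS2 hS3 h0 h1 h2 h3
      have hd : ∀ p q : Zd 3, ‖u p - u q‖ ≤ 2 := fun p q =>
        (norm_sub_le _ _).trans (by rw [hu, hu]; norm_num)
      have ha := hd (y + unitVec (σ 0)) y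
      have hb := hd (y + unitVec (σ 0) + unitVec (σ 1)) (y + unitVec (σ 0))
      have hc := hd (y + unitVec (σ 0) + unitVec (σ 1) + unitVec (σ 2)) (y + unitVec (σ 0) + unitVec (σ 1))
      have h6 : ‖I x - u y‖ ≤ 6 := by linarith
      nlinarith [norm_nonneg (I x - u y)]
    have hint1 : IntegrableOn (fun x => (‖I x‖ - 1) ^ 2)
        {x : EuclideanSpace ℝ (Fin 3) | ∀ i, (y i : ℝ) < x i ∧ x i < y i + 1} volume :=
      Measure.integrableOn_of_bounded hfin hcont.aestronglyMeasurable
        ((ae_restrict_iff' (measurableSet_cube y)).mpr (ae_of_all _ fun x hx => by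
          rw [Real.norm_of_nonneg (by positivity)]; exact (hptw x).trans (hB x hx)))
    have hint2 : IntegrableOn (fun x => ‖I x - u y‖ ^ 2)
        {x : EuclideanSpace ℝ (Fin 3) | ∀ i, (y i : ℝ) < x i ∧ x i < y i + 1} volume :=
      Measure.integrableOn_of_bounded hfin hcont2.aestronglyMeasurable
        ((ae_restrict_iff' (measurableSet_cube y)).mpr (ae_of_all _ fun x hx => by
          rw [Real.norm_of_nonneg (by positivity)]; exact hB x hx))
    refine ⟨hint1, ?_⟩
    calc _ ≤ ∫ x in {x : EuclideanSpace ℝ (Fin 3) | ∀ i, (y i : ℝ) < x i ∧ x i < y i + 1}, ‖I x - u y‖ ^ 2 :=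
          setIntegral_mono_on hint1 hint2 (measurableSet_cube y) (fun x _ => hptw x)
      _ ≤ _ := integral_cube_normSq_sub_le φ hφ S u I hI y (hcorner y hy)
  rw [← setIntegral_congr_set (iUnion_cube_ae_eq_bigBox z R),
    integral_biUnion_finset (box z R) (fun y _ => measurableSet_cube y) hdisj (fun y hy => (hcube y hy).1)]
  calc ∑ y ∈ box z R, ∫ x in {x : EuclideanSpace ℝ (Fin 3) | ∀ i, (y i : ℝ) < x i ∧ x i < y i + 1}, (‖I x‖ - 1) ^ 2
      ≤ ∑ y ∈ box z R, 3 * ∫ x in {x : EuclideanSpace ℝ (Fin 3) | ∀ i, (y i : ℝ) < x i ∧ x i < y i + 1},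
          ∑ i : Fin 3, ‖fderiv ℝ I x (EuclideanSpace.single i (1:ℝ))‖ ^ 2 :=
        Finset.sum_le_sum fun y hy => (hcube y hy).2
    _ = 3 * ((1 / 6 : ℝ) * ∑ y ∈ box z R, ∑ σ : Equiv.Perm (Fin 3), (‖u (y + unitVec (σ 0)) - u y‖ ^ 2
        + ‖u (y + unitVec (σ 0) + unitVec (σ 1)) - u (y + unitVec (σ 0))‖ ^ 2
        + ‖u (y + unitVec (σ 0) + unitVec (σ 1) + unitVec (σ 2)) - u (y + unitVec (σ 0) + unitVec (σ 1))‖ ^ 2)) := by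
        rw [← Finset.mul_sum, Finset.mul_sum (box z R) _ (1 / 6 : ℝ)]
        congr 1
        exact Finset.sum_congr rfl fun y hy => integral_cube_energyDensity_eq φ hφ S u I hI y (hcorner y hy)
    _ ≤ 3 * ∑ w ∈ box z (R + 1), ∑ μ : Fin 3, ‖u (w + unitVec μ) - u w‖ ^ 2 := by
        have := sixth_sum_paths_le_bondEnergy u z R
        linarith

end Summit.QuantumFields.YangMills.Theorems.PoincareLipschitzKuhnSphereDistance
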